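import Summits.CriticalPhenomena.PercolationContinuityZ3.Theorems.PercNearOneGluingNoHeavyQuantTransportCell
import Summits.CriticalPhenomena.PercolationContinuityZ3.Theorems.PercNearOneGluingNoHeavyQuantOneBig
import HarnessLib

/-!
# QUANT lane R8, Conjecture DIB\* — the LIGHT-LARGEST CELL at floors `x ≥ 7/8` (transport + Cantelli):
# together with the transport cell, EVERY instance with gates `≥ x²` is a theorem at these floors

builds on p205010 (kernel theorem, internal audit signed; external expert review pending)

Support file (`--supports stmt-CriticalPhenomena-4575`), QUANT lane typer seat prim-quant-stmt (gen 21); sequel of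
`…QuantTransportCell` (p275739).  Theorems only, no definitions, no sorries, standard axioms.

THE CELL.  Floor `7/8 ≤ x < 1`, all gates `≥ x²`, a LARGEST blob `k₀` of size `b ≤ j` which is LIGHT (`p = g k₀ < x`, rate
`φ = (p − x²)/(1 − x) ∈ [0, x)`), discounted credit `> 2j`.  Split at `k₀` (`term_cond`): `P(N ≥ j+1) = p(1 − L) + (1 − p)H` with
`L = P(N_R ≤ j − b)`, `H = P(N_R ≥ j+1)` for the rest `R`.  TRANSPORT (`IndepBlob.transport_tail`, `k = 2` because `k₀` is largest):
`x⁴·L ≤ (1 − x²)²·H`, whence for ANY certified `h ≤ H`: `x⁴p + h·(x⁴(1 − p) − p(1 − x²)²) ≤ x⁴·P` (`RootDec.term_ge_of_transport_lower`,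
the master rule of this file).  CANTELLI for the rest (`term_ge_of_cantelli`): `H ≥ D²/(V + D²)`, `D = m_R − j`, `V = Σ_R a²g(1−g)`.
BOOKKEEPING: `m_R ≥ C_R > 2j − bφ` (credit ≤ mean), so `D > j − bφ ≥ b(1 − φ)`; `V ≤ b·Σ_R a g(1−g) ≤ b(1 − x)(2m_R − C_R) <
b(1 − x)(2D + bφ)` (sizes `≤ b`, `IndepBlob.gate_var_le`).  THE REAL INEQUALITY (`lightLargest_core`): these force
`x⁴(x − p)·V ≤ D²·((1 − x)x⁴ − p(1 − x²)²)`, which is exactly `h·E ≥ x⁴(x − p)` for the Cantelli `h`; the proof reduces (monotonicity in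
`D ≥ b(1 − φ)`, then `b²` factors out) to the one-variable family `g_x(u) = (1−x²)²u³ + (2x⁵ − x³ + x² − 1)u² − x⁵(1−x)u + x⁴(1−x)² ≥ 0`
(`u = 1 − φ`), a cubic with non-negative leading term whose quadratic part has NEGATIVE DISCRIMINANT iff `x⁶ ≤ 4(2x⁵ − x³ + x² − 1)` —
true from `x ≈ 0.869` on; we take `x ≥ 7/8` (`transport_poly_disc`, slack `0.037` at `7/8`).
RESULT: **`RootDec.tail_ge_of_lightLargest_of_credit`** (the cell) and **`RootDec.tail_ge_of_largest_of_credit`: at every floor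
`7/8 ≤ x < 1`, every instance of Conjecture DIB\* with all gates `≥ x²` and a largest blob of size `≤ j` (ANY gate) satisfies the row.**
The remaining hypotheses of `DIBStar x` (junk lights `g < x²`, empty blobs, heavy giants) are the lane's standard WLOG reductions
(next file: `DIBStar x` for all `x ∈ [7/8, 1)`).
Numerics (seat folder work/explore/tr6.py): adversarial climbs of the light-largest cell at `x ∈ [0.86, 0.99]` with transport + exact
Cantelli, 0 failures (min normalised margin 0.005 at `x = 0.86`, `≥ 0.088` for `x ≥ 0.9`); the relaxed inequality proved here holds
from `x ≈ 0.869`.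

NOVELTY.  presearch: as for `…QuantTransportCell` (biased EKR / Harris–Kleitman transport; Cantelli) — the combination and the cell
are [this work]; the gluing rows served [cite: KozmaNitzan2024, Conjecture 3 (p. 15)]; product weights [cite: Grimmett1999, §1.3 p. 10].
-/

namespace Summit.CriticalPhenomena.PercolationContinuityZ3.Theorems

namespace Quant

namespace RootDec

open Finset

variable {κ : Type} [Fintype κ] [DecidableEq κ]

/-- product-Bernoulli weight of the set `W` of open blobs (as in `…QuantRootReduction`) -/
local notation3 "wt[" g ", " W "]" => ∏ k, (if k ∈ (W : Finset κ) then (g : κ → ℝ) k else 1 - (g : κ → ℝ) k)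

/-- the TERM tail `P(s + Σ_{k open} a k ≥ j+1)` (as in `…QuantRootReduction`) -/
local notation3 "TERM[" s ", " a ", " g ", " j "]" =>
  ∑ W : Finset κ, wt[g, W] * (if (j : ℕ) + 1 ≤ (s : ℕ) + ∑ k ∈ W, (a : κ → ℕ) k then (1 : ℝ) else 0)

/-! ### 1. The split with a certified upper tail of the rest -/

/-- **The split with a certified upper tail** (master rule).  Gates in `[0,1]`, all `≥ g₀ ≥ 1/2`; split blob `k₀` with `a k₀ ≤ j`
and gate `p = g k₀`; every other size `≤ s`, `(k − 1)·s ≤ a k₀`; total mass `≥ 2j + 1`; a real `h ≤ P(N_rest ≥ j+1)` (any kernel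
lower bound); and the sign condition `p(1 − g₀)^k ≤ (1 − p)g₀^k`.  Then `g₀^k·p + h·(g₀^k(1 − p) − p(1 − g₀)^k) ≤ g₀^k · P(N ≥ j+1)`
(`term_cond` + `transport_tail`: `P = p(1 − L) + (1 − p)H ≥ p + H·((1 − p) − p(1−g₀)^k/g₀^k)`). [this work] -/
theorem term_ge_of_transport_lower (a : κ → ℕ) (g : κ → ℝ) (j : ℕ) (g₀ h : ℝ) (k₀ : κ) (s k : ℕ)
    (hg : ∀ i, 0 ≤ g i ∧ g i ≤ 1) (hhalf : 1 / 2 ≤ g₀) (hg₀ : ∀ i, g₀ ≤ g i)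
    (hkj : a k₀ ≤ j) (hsize : ∀ i, i ≠ k₀ → a i ≤ s) (hk : (k - 1) * s ≤ a k₀)
    (hmass : 2 * j + 1 ≤ ∑ i, a i)
    (hsign : g k₀ * (1 - g₀) ^ k ≤ (1 - g k₀) * g₀ ^ k)
    (hh : h ≤ ∑ W : Finset κ, wt[g, W] * (if j + 1 ≤ ∑ i ∈ W, Function.update a k₀ 0 i then (1 : ℝ) else 0)) :
    g₀ ^ k * g k₀ + h * (g₀ ^ k * (1 - g k₀) - g k₀ * (1 - g₀) ^ k) ≤
      g₀ ^ k * ∑ W : Finset κ, wt[g, W] * (if j + 1 ≤ ∑ i ∈ W, a i then (1 : ℝ) else 0) := by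
  have hg₀0 : 0 < g₀ := by linarith
  have h1g₀ : 0 ≤ 1 - g₀ := by linarith [hg₀ k₀, (hg k₀).2]
  set b : ℕ := a k₀ with hb
  set a' : κ → ℕ := Function.update a k₀ 0 with ha'
  have ha'k : a' k₀ = 0 := by rw [ha', Function.update_self]
  have ha'ne : ∀ i, i ≠ k₀ → a' i = a i := fun i hi => by rw [ha', Function.update_of_ne hi]
  have ha's : ∀ i, a' i ≤ s := by
    intro i; by_cases hi : i = k₀
    · rw [hi, ha'k]; exact Nat.zero_le _
    · rw [ha'ne i hi]; exact hsize i hi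
  have hmass' : j + (j - b) + 1 ≤ ∑ i, a' i := by
    have h1 : ∑ i, a i = a k₀ + ∑ i ∈ Finset.univ.erase k₀, a i := (Finset.add_sum_erase _ _ (Finset.mem_univ k₀)).symm
    have h2 : ∑ i, a' i = a' k₀ + ∑ i ∈ Finset.univ.erase k₀, a' i := (Finset.add_sum_erase _ _ (Finset.mem_univ k₀)).symm
    have h3 : ∑ i ∈ Finset.univ.erase k₀, a' i = ∑ i ∈ Finset.univ.erase k₀, a i :=
      Finset.sum_congr rfl fun i hi => by rw [ha'ne i (Finset.ne_of_mem_erase hi)]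
    rw [h2, h3, ha'k]
    omega
  set L : ℝ := ∑ W ∈ (Finset.univ : Finset (Finset κ)).filter (fun W => ∑ i ∈ W, a' i ≤ j - b), wt[g, W] with hL
  set H : ℝ := ∑ V ∈ (Finset.univ : Finset (Finset κ)).filter (fun V => j + 1 ≤ ∑ i ∈ V, a' i), wt[g, V] with hH
  have hw0 : ∀ W : Finset κ, 0 ≤ wt[g, W] := IndepBlob.bernoulliWeight_nonneg (fun i => (hg i).1) (fun i => (hg i).2)
  have htr : g₀ ^ k * L ≤ (1 - g₀) ^ k * H :=
    IndepBlob.transport_tail g a' g₀ hhalf hg₀ (fun i => (hg i).2) (j - b) j s k (Nat.sub_le j b) hmass' ha's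
      (by rw [Nat.sub_sub_self hkj]; exact hk)
  have hT1 : TERM[b, a', g, j] = 1 - L := by
    rw [term_shift b a' g j hkj, hL, Finset.sum_filter, eq_sub_iff_add_eq, ← Finset.sum_add_distrib]
    refine Eq.trans (Finset.sum_congr rfl fun W _ => ?_) (IndepBlob.sum_bernoulliWeight g)
    by_cases h : j - b + 1 ≤ ∑ i ∈ W, a' i
    · rw [if_pos h, if_neg (by omega), mul_one, add_zero]
    · rw [if_neg h, if_pos (by omega), mul_zero, zero_add]
  have hT0 : ∑ W : Finset κ, wt[g, W] * (if j + 1 ≤ ∑ i ∈ W, a' i then (1 : ℝ) else 0) = H := by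
    rw [hH, Finset.sum_filter]
    refine Finset.sum_congr rfl fun W _ => ?_
    split_ifs <;> simp
  have hhH : h ≤ H := hh.trans_eq hT0
  have e := term_cond 0 a g j k₀
  simp only [zero_add] at e
  rw [e, show a k₀ = b from rfl, show Function.update a k₀ 0 = a' from rfl, hT1, hT0]
  set p : ℝ := g k₀ with hp
  set c : ℝ := g₀ ^ k with hc
  set d : ℝ := (1 - g₀) ^ k with hd
  have hp0 : 0 ≤ p := (hg k₀).1
  have hpLH : p * (c * L) ≤ p * (d * H) := mul_le_mul_of_nonneg_left htr hp0
  have key : c * (p * (1 - L) + (1 - p) * H) - (c * p + h * (c * (1 - p) - p * d)) =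
      (p * (d * H) - p * (c * L)) + (H - h) * (c * (1 - p) - p * d) := by ring
  have hbr : 0 ≤ c * (1 - p) - p * d := by rw [hc, hd]; linarith
  nlinarith [mul_nonneg (sub_nonneg.2 hhH) hbr]

/-! ### 2. One-variable polynomial facts at `x ≥ 7/8` -/

/-- `0 < 2x⁵ − x³ + x² − 1` for `7/8 ≤ x ≤ 1` (`x³ ≤ x²` and `2(7/8)⁵ > 1`). [this work] -/
theorem transport_poly_A (x : ℝ) (hx : 7 / 8 ≤ x) (hx1 : x ≤ 1) : 0 < 2 * x ^ 5 - x ^ 3 + x ^ 2 - 1 := by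
  have hx0 : 0 ≤ x := by linarith
  have h5 : (7 / 8 : ℝ) ^ 5 ≤ x ^ 5 := pow_le_pow_left₀ (by norm_num) hx 5
  have h32 : x ^ 3 ≤ x ^ 2 := by nlinarith [mul_le_mul_of_nonneg_left hx1 (sq_nonneg x)]
  nlinarith

/-- The discriminant condition: `x⁶ ≤ 4(2x⁵ − x³ + x² − 1)` for `7/8 ≤ x ≤ 1` (Taylor expansion at `7/8` in `t = x − 7/8 ∈ [0, 1/8]`:
all coefficients positive except `−t⁶ ≥ −t⁵/8`; slack `0.037` at `x = 7/8`). [this work] -/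
theorem transport_poly_disc (x : ℝ) (hx : 7 / 8 ≤ x) (hx1 : x ≤ 1) : x ^ 6 ≤ 4 * (2 * x ^ 5 - x ^ 3 + x ^ 2 - 1) := by
  set t : ℝ := x - 7 / 8 with ht
  have ht0 : 0 ≤ t := by linarith
  have ht1 : t ≤ 1 / 8 := by linarith
  have hx' : x = 7 / 8 + t := by linarith
  have key : 4 * (2 * x ^ 5 - x ^ 3 + x ^ 2 - 1) - x ^ 6 =
      9775 / 262144 + 297899 / 16384 * t + 156881 / 4096 * t ^ 2 + 5613 / 128 * t ^ 3 + 1505 / 64 * t ^ 4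
        + 11 / 4 * t ^ 5 - t ^ 6 := by
    rw [hx']; ring
  have h2 : 0 ≤ t ^ 2 := pow_nonneg ht0 2
  have h3 : 0 ≤ t ^ 3 := pow_nonneg ht0 3
  have h4 : 0 ≤ t ^ 4 := pow_nonneg ht0 4
  have h5 : 0 ≤ t ^ 5 := pow_nonneg ht0 5
  have h6 : t ^ 6 ≤ 1 / 8 * t ^ 5 := by
    have := mul_le_mul_of_nonneg_left ht1 h5
    calc t ^ 6 = t ^ 5 * t := by ring
      _ ≤ t ^ 5 * (1 / 8) := this
      _ = 1 / 8 * t ^ 5 := by ring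
  nlinarith

/-- **The cubic family `g_x(u) ≥ 0`** (`u ≥ 0`, `7/8 ≤ x ≤ 1`):
`(1−x²)²u³ + (2x⁵ − x³ + x² − 1)u² − x⁵(1−x)u + x⁴(1−x)² ≥ 0` — non-negative cubic term plus a quadratic with positive leading
coefficient and non-positive discriminant (`transport_poly_disc`). [this work] -/
theorem transport_cubic_nonneg (x u : ℝ) (hx : 7 / 8 ≤ x) (hx1 : x ≤ 1) (hu : 0 ≤ u) :
    0 ≤ (1 - x ^ 2) ^ 2 * u ^ 3 + (2 * x ^ 5 - x ^ 3 + x ^ 2 - 1) * u ^ 2 - x ^ 5 * (1 - x) * u + x ^ 4 * (1 - x) ^ 2 := by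
  have hx0 : 0 ≤ x := by linarith
  set α : ℝ := 2 * x ^ 5 - x ^ 3 + x ^ 2 - 1 with hα
  have hα0 : 0 < α := transport_poly_A x hx hx1
  have hdisc : x ^ 6 ≤ 4 * α := transport_poly_disc x hx hx1
  -- the quadratic part: `4α·q(u) = (2αu − x⁵(1−x))² + x⁴(1−x)²(4α − x⁶)`
  have hq : 0 ≤ α * u ^ 2 - x ^ 5 * (1 - x) * u + x ^ 4 * (1 - x) ^ 2 := by
    have h4 : 4 * α * 0 ≤ 4 * α * (α * u ^ 2 - x ^ 5 * (1 - x) * u + x ^ 4 * (1 - x) ^ 2) := by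
      have key : 4 * α * (α * u ^ 2 - x ^ 5 * (1 - x) * u + x ^ 4 * (1 - x) ^ 2) =
          (2 * α * u - x ^ 5 * (1 - x)) ^ 2 + x ^ 4 * (1 - x) ^ 2 * (4 * α - x ^ 6) := by ring
      rw [mul_zero, key]
      have : 0 ≤ x ^ 4 * (1 - x) ^ 2 * (4 * α - x ^ 6) := by
        have : 0 ≤ 4 * α - x ^ 6 := by linarith
        positivity
      nlinarith [sq_nonneg (2 * α * u - x ^ 5 * (1 - x))]
    exact le_of_mul_le_mul_left h4 (by linarith)
  have hcub : 0 ≤ (1 - x ^ 2) ^ 2 * u ^ 3 := by positivity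
  linarith

/-! ### 3. The real inequality of the cell -/

/-- **The real inequality of the light-largest cell.**  Floor `7/8 ≤ x < 1`, rate `φ ∈ [0, x]` of the split blob (gate
`p = x² + φ(1−x)`), its size `b ≥ 0`, the rest's excess mean `D ≥ b(1 − φ)` and variance `V ≤ b(1 − x)(2D + bφ)`.  Then
`x⁴(x − p)·V ≤ D²·((1 − x)x⁴ − p(1 − x²)²)`.  Proof: with `u = 1 − φ`, `K = x⁴ − p(1−x)(1+x)²`, the claim is `f(D) ≥ 0` for
`f(D) = K D² − 2x⁴b(1−x)(x−φ)D − x⁴b²(1−x)(x−φ)φ`; `f(D) = b²·g_x(u) + (D − bu)(K(D + bu) − 2x⁴b(1−x)(x−φ))` with `K ≥ x⁴(1−x)`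
(`transport_poly_A`) and `g_x(u) ≥ 0` (`transport_cubic_nonneg`). [this work] -/
theorem lightLargest_core (x φ b D V : ℝ) (hx : 7 / 8 ≤ x) (hx1 : x < 1) (hφx : φ ≤ x) (hb : 0 ≤ b)
    (hD : b * (1 - φ) ≤ D) (hV : V ≤ b * (1 - x) * (2 * D + b * φ)) :
    x ^ 4 * (x - (x ^ 2 + φ * (1 - x))) * V ≤ D ^ 2 * ((1 - x) * x ^ 4 - (x ^ 2 + φ * (1 - x)) * (1 - x ^ 2) ^ 2) := by
  have hx0 : 0 ≤ x := by linarith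
  have hy : 0 < 1 - x := by linarith
  have hu0 : 0 ≤ 1 - φ := by linarith
  have hD0 : 0 ≤ D := le_trans (mul_nonneg hb hu0) hD
  -- `K ≥ x⁴(1 − x) ≥ 0`
  set K : ℝ := x ^ 4 - (x ^ 2 + φ * (1 - x)) * (1 - x) * (1 + x) ^ 2 with hK
  have hA := transport_poly_A x hx hx1.le
  have hKdecomp : K = (x ^ 5 + x ^ 4 - x ^ 3 + x ^ 2 - 1) + (1 - φ) * (1 - x ^ 2) ^ 2 := by rw [hK]; ring
  have hKge : x ^ 4 * (1 - x) ≤ K := by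
    rw [hKdecomp]
    have : 0 ≤ (1 - φ) * (1 - x ^ 2) ^ 2 := by positivity
    nlinarith
  have hK0 : 0 ≤ K := le_trans (by positivity) hKge
  -- `g_x(u) ≥ 0` at `u = 1 − φ`
  have hg := transport_cubic_nonneg x (1 - φ) hx hx1.le hu0
  -- the identity `f(D) = b²·g + (D − bu)(K(D + bu) − 2x⁴b(1−x)(x−φ))`
  have hf_id : K * D ^ 2 - 2 * x ^ 4 * b * (1 - x) * (x - φ) * D - x ^ 4 * b ^ 2 * (1 - x) * (x - φ) * φ =
      b ^ 2 * ((1 - x ^ 2) ^ 2 * (1 - φ) ^ 3 + (2 * x ^ 5 - x ^ 3 + x ^ 2 - 1) * (1 - φ) ^ 2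
        - x ^ 5 * (1 - x) * (1 - φ) + x ^ 4 * (1 - x) ^ 2)
      + (D - b * (1 - φ)) * (K * (D + b * (1 - φ)) - 2 * x ^ 4 * b * (1 - x) * (x - φ)) := by
    rw [hK]; ring
  -- the second factor is non-negative: `K(D + bu) ≥ x⁴(1−x)(D + bu) ≥ 2x⁴(1−x)·bu ≥ 2x⁴b(1−x)(x − φ)` as `u = 1 − φ ≥ x − φ`
  have hfac : 0 ≤ K * (D + b * (1 - φ)) - 2 * x ^ 4 * b * (1 - x) * (x - φ) := by
    have h1 : x ^ 4 * (1 - x) * (D + b * (1 - φ)) ≤ K * (D + b * (1 - φ)) :=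
      mul_le_mul_of_nonneg_right hKge (by positivity)
    have h2 : 2 * x ^ 4 * b * (1 - x) * (x - φ) ≤ x ^ 4 * (1 - x) * (D + b * (1 - φ)) := by
      have h21 : b * (1 - φ) + b * (1 - φ) ≤ D + b * (1 - φ) := by linarith
      have h22 : x - φ ≤ 1 - φ := by linarith
      have h23 : 0 ≤ x ^ 4 * (1 - x) * b := by positivity
      nlinarith [mul_le_mul_of_nonneg_left h22 h23, mul_le_mul_of_nonneg_left h21 (by positivity : 0 ≤ x ^ 4 * (1 - x))]
    linarith
  have hf : 0 ≤ K * D ^ 2 - 2 * x ^ 4 * b * (1 - x) * (x - φ) * D - x ^ 4 * b ^ 2 * (1 - x) * (x - φ) * φ := by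
    rw [hf_id]
    have : 0 ≤ b ^ 2 * ((1 - x ^ 2) ^ 2 * (1 - φ) ^ 3 + (2 * x ^ 5 - x ^ 3 + x ^ 2 - 1) * (1 - φ) ^ 2
        - x ^ 5 * (1 - x) * (1 - φ) + x ^ 4 * (1 - x) ^ 2) := mul_nonneg (sq_nonneg b) hg
    nlinarith [mul_nonneg (sub_nonneg.2 hD) hfac]
  -- conclude: `x⁴(x − p)V ≤ x⁴(1−x)(x−φ)·b(1−x)(2D + bφ) = (1−x)(K D² − f(D)) ≤ (1−x) K D² = D²((1−x)x⁴ − p(1−x²)²)`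
  have hxp : x - (x ^ 2 + φ * (1 - x)) = (1 - x) * (x - φ) := by ring
  have hcoef : 0 ≤ x ^ 4 * ((1 - x) * (x - φ)) := by
    have : 0 ≤ x - φ := by linarith
    positivity
  have step1 : x ^ 4 * (x - (x ^ 2 + φ * (1 - x))) * V ≤ x ^ 4 * ((1 - x) * (x - φ)) * (b * (1 - x) * (2 * D + b * φ)) := by
    rw [hxp]; exact mul_le_mul_of_nonneg_left hV hcoef
  have step2 : x ^ 4 * ((1 - x) * (x - φ)) * (b * (1 - x) * (2 * D + b * φ)) =
      (1 - x) * (K * D ^ 2 - (K * D ^ 2 - 2 * x ^ 4 * b * (1 - x) * (x - φ) * D - x ^ 4 * b ^ 2 * (1 - x) * (x - φ) * φ)) := by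
    ring
  have step3 : D ^ 2 * ((1 - x) * x ^ 4 - (x ^ 2 + φ * (1 - x)) * (1 - x ^ 2) ^ 2) = (1 - x) * (K * D ^ 2) := by
    rw [hK]; ring
  rw [step3]
  refine step1.trans ?_
  rw [step2]
  exact mul_le_mul_of_nonneg_left (by linarith) hy.le

/-! ### 4. The cell -/

/-- **THE LIGHT-LARGEST CELL OF DIB\* — floors `7/8 ≤ x < 1`.**  Gates in `[x², 1]`, a blob `k₀` of maximal size with `a k₀ ≤ j` and
LIGHT (`g k₀ < x`), discounted credit `> 2j` ⟹ the row `x ≤ P(N ≥ j+1)` (transport + Cantelli for the rest + `lightLargest_core`).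
[this work] -/
theorem tail_ge_of_lightLargest_of_credit (a : κ → ℕ) (g : κ → ℝ) (j : ℕ) (x : ℝ) (hx : 7 / 8 ≤ x) (hx1 : x < 1)
    (hg : ∀ i, 0 ≤ g i ∧ g i ≤ 1) (hfloor : ∀ i, x ^ 2 ≤ g i) (k₀ : κ) (hlight : g k₀ < x)
    (hlargest : ∀ i, a i ≤ a k₀) (hkj : a k₀ ≤ j)
    (hcredit : (2 * j : ℝ) < ∑ i, (a i : ℝ) * (if x ≤ g i then g i else (g i - x ^ 2) / (1 - x))) :
    x ≤ ∑ W : Finset κ, wt[g, W] * (if j + 1 ≤ ∑ i ∈ W, a i then (1 : ℝ) else 0) := by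
  have hx0 : 0 ≤ x := by linarith
  have hy : 0 < 1 - x := by linarith
  have hhalf : 1 / 2 ≤ x ^ 2 := by nlinarith
  set φ : κ → ℝ := fun i => if x ≤ g i then g i else (g i - x ^ 2) / (1 - x) with hφ
  -- the split blob: gate `g k₀ = x² + φ₀(1−x)`, `0 ≤ φ₀ ≤ x`
  set φ₀ : ℝ := (g k₀ - x ^ 2) / (1 - x) with hφ₀
  have hφk : φ k₀ = φ₀ := by
    simp only [hφ, hφ₀]
    rw [if_neg (not_le.2 hlight)]
  have hpφ : g k₀ = x ^ 2 + φ₀ * (1 - x) := by rw [hφ₀, div_mul_cancel₀ _ hy.ne']; ring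
  have hφ₀x : φ₀ ≤ x := by rw [hφ₀, div_le_iff₀ hy]; nlinarith
  -- the rest
  set b : ℕ := a k₀ with hb
  set a' : κ → ℕ := Function.update a k₀ 0 with ha'
  have ha'k : a' k₀ = 0 := by rw [ha', Function.update_self]
  have ha'ne : ∀ i, i ≠ k₀ → a' i = a i := fun i hi => by rw [ha', Function.update_of_ne hi]
  have ha'0 : ∀ i, (0 : ℝ) ≤ a' i := fun i => Nat.cast_nonneg _
  have ha'b : ∀ i, (a' i : ℝ) ≤ b := by
    intro i; by_cases hi : i = k₀
    · rw [hi, ha'k, Nat.cast_zero]; exact Nat.cast_nonneg _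
    · rw [ha'ne i hi]; exact_mod_cast hlargest i
  -- credit split: `b·φ₀ + C_R > 2j`
  set CR : ℝ := ∑ i, (a' i : ℝ) * φ i with hCR
  have hsplit : ∑ i, (a i : ℝ) * φ i = (b : ℝ) * φ₀ + CR := by
    have h1 : ∑ i, (a i : ℝ) * φ i = (a k₀ : ℝ) * φ k₀ + ∑ i ∈ Finset.univ.erase k₀, (a i : ℝ) * φ i :=
      (Finset.add_sum_erase _ _ (Finset.mem_univ k₀)).symm
    have h2 : CR = (a' k₀ : ℝ) * φ k₀ + ∑ i ∈ Finset.univ.erase k₀, (a' i : ℝ) * φ i :=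
      (Finset.add_sum_erase _ _ (Finset.mem_univ k₀)).symm
    have h3 : ∑ i ∈ Finset.univ.erase k₀, (a' i : ℝ) * φ i = ∑ i ∈ Finset.univ.erase k₀, (a i : ℝ) * φ i :=
      Finset.sum_congr rfl fun i hi => by rw [ha'ne i (Finset.ne_of_mem_erase hi)]
    rw [h2, h3, ha'k, Nat.cast_zero, zero_mul, zero_add, h1, hφk]
  have hcr : (2 * j : ℝ) < (b : ℝ) * φ₀ + CR := by rw [← hsplit]; exact hcredit
  -- rest aggregates: mean `mR ≥ CR`, variance `VR ≤ b(1−x)(2 mR − CR)`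
  set mR : ℝ := ∑ i, (a' i : ℝ) * g i with hmR
  set VR : ℝ := ∑ i, (a' i : ℝ) ^ 2 * g i * (1 - g i) with hVR
  have hmC : CR ≤ mR := Finset.sum_le_sum fun i _ =>
    mul_le_mul_of_nonneg_left (IndepBlob.phi_le_gate x (g i) hx0 hx1) (ha'0 i)
  have hV0 : 0 ≤ VR := Finset.sum_nonneg fun i _ => by
    have := mul_nonneg (mul_nonneg (sq_nonneg (a' i : ℝ)) (hg i).1) (sub_nonneg.2 (hg i).2)
    simpa [mul_assoc] using this
  have hVb : VR ≤ (b : ℝ) * (1 - x) * (2 * mR - CR) := by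
    have h1 : VR ≤ ∑ i, (b : ℝ) * ((a' i : ℝ) * g i * (1 - g i)) := Finset.sum_le_sum fun i _ => by
      have hgg : 0 ≤ g i * (1 - g i) := mul_nonneg (hg i).1 (sub_nonneg.2 (hg i).2)
      have := mul_le_mul_of_nonneg_right (ha'b i) (mul_nonneg (ha'0 i) hgg)
      nlinarith
    have h2 : ∑ i, (b : ℝ) * ((a' i : ℝ) * g i * (1 - g i)) ≤ ∑ i, (b : ℝ) * ((a' i : ℝ) * ((1 - x) * (2 * g i - φ i))) :=
      Finset.sum_le_sum fun i _ => mul_le_mul_of_nonneg_left (by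
        have := mul_le_mul_of_nonneg_left (IndepBlob.gate_var_le x (g i) hx0 hx1) (ha'0 i)
        simpa [mul_assoc] using this) (Nat.cast_nonneg _)
    have h3 : ∑ i, (b : ℝ) * ((a' i : ℝ) * ((1 - x) * (2 * g i - φ i))) = (b : ℝ) * (1 - x) * (2 * mR - CR) :=
      calc ∑ i, (b : ℝ) * ((a' i : ℝ) * ((1 - x) * (2 * g i - φ i)))
          = ∑ i, ((b : ℝ) * (1 - x)) * (2 * ((a' i : ℝ) * g i) - (a' i : ℝ) * φ i) :=
            Finset.sum_congr rfl fun i _ => by ring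
        _ = ((b : ℝ) * (1 - x)) * ∑ i, (2 * ((a' i : ℝ) * g i) - (a' i : ℝ) * φ i) := by rw [Finset.mul_sum]
        _ = (b : ℝ) * (1 - x) * (2 * mR - CR) := by rw [hmR, hCR, Finset.sum_sub_distrib, ← Finset.mul_sum]
    exact (h1.trans h2).trans_eq h3
  -- `D = mR − j > j − bφ₀ ≥ b(1 − φ₀)`
  have hbj : (b : ℝ) ≤ j := by exact_mod_cast hkj
  have hb0 : (0 : ℝ) ≤ b := Nat.cast_nonneg _
  have hmj : (j : ℝ) < mR := by nlinarith
  set D : ℝ := mR - j with hDdef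
  have hD : (b : ℝ) * (1 - φ₀) ≤ D := by nlinarith
  have hVD : VR ≤ (b : ℝ) * (1 - x) * (2 * D + b * φ₀) := by
    refine hVb.trans (mul_le_mul_of_nonneg_left (by linarith) (mul_nonneg hb0 hy.le))
  -- total mass `≥ 2j + 1`
  have hmass : 2 * j + 1 ≤ ∑ i, a i := by
    have h1 : ∑ i, (a i : ℝ) * φ i ≤ ∑ i, (a i : ℝ) :=
      Finset.sum_le_sum fun i _ => mul_le_of_le_one_right (Nat.cast_nonneg _)
        (IndepBlob.creditRate_le_one x (g i) hx1 (hg i).2)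
    have h2 : ((2 * j : ℕ) : ℝ) < ((∑ i, a i : ℕ) : ℝ) := by push_cast; linarith
    have h3 : 2 * j < ∑ i, a i := by exact_mod_cast h2
    omega
  -- Cantelli for the rest: `H ≥ 1 − VR/(VR + D²)`
  have hcant : 1 - VR / (VR + (mR - j) ^ 2) ≤
      ∑ W : Finset κ, wt[g, W] * (if j + 1 ≤ ∑ i ∈ W, a' i then (1 : ℝ) else 0) := by
    have h := term_ge_of_cantelli 0 a' g j hg (Nat.zero_le j) (by simpa using hmj)
    simpa only [Nat.sub_zero, zero_add] using h
  -- the master rule with `g₀ = x²`, `k = 2`, `h = 1 − VR/(VR + D²)`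
  have hsign : g k₀ * (1 - x ^ 2) ^ 2 ≤ (1 - g k₀) * (x ^ 2) ^ 2 := by
    have hρ := transport_floor_two x (by linarith) hx1.le
    have hc0 : 0 ≤ (x ^ 2) ^ 2 := by positivity
    nlinarith [(hg k₀).2, mul_le_mul_of_nonneg_right (by linarith : 1 - x ≤ 1 - g k₀) hc0, sq_nonneg (1 - x ^ 2)]
  have hmain := term_ge_of_transport_lower a g j (x ^ 2) (1 - VR / (VR + (mR - j) ^ 2)) k₀ (a k₀) 2 hg hhalf hfloor hkj
    (fun i _ => hlargest i) (by omega) hmass hsign hcant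
  -- the real inequality
  have core := lightLargest_core x φ₀ b D VR hx hx1 hφ₀x hb0 hD hVD
  rw [← hpφ] at core
  set p : ℝ := g k₀ with hp
  have hDpos : 0 < D := by rw [hDdef]; linarith
  have hden : 0 < VR + D ^ 2 := by positivity
  have hh_eq : 1 - VR / (VR + (mR - j) ^ 2) = D ^ 2 / (VR + D ^ 2) := by
    rw [← hDdef]; field_simp; ring
  rw [hh_eq] at hmain
  set c : ℝ := (x ^ 2) ^ 2 with hc
  set d : ℝ := (1 - x ^ 2) ^ 2 with hd
  have hc4 : c = x ^ 4 := by rw [hc]; ring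
  have hc0 : 0 < c := by positivity
  -- `c(x − p)(VR + D²) ≤ D²·E` with `E = c(1 − p) − p·d`
  have hE : c * (x - p) * (VR + D ^ 2) ≤ D ^ 2 * (c * (1 - p) - p * d) := by
    have e1 : D ^ 2 * (c * (1 - p) - p * d) = D ^ 2 * ((1 - x) * x ^ 4 - p * (1 - x ^ 2) ^ 2) + c * (x - p) * D ^ 2 := by
      rw [hc4, hd]; ring
    rw [e1]
    have e2 : c * (x - p) * (VR + D ^ 2) = x ^ 4 * (x - p) * VR + c * (x - p) * D ^ 2 := by rw [hc4]; ring
    rw [e2]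
    linarith [core]
  have hE' : c * (x - p) ≤ D ^ 2 / (VR + D ^ 2) * (c * (1 - p) - p * d) := by
    rw [div_mul_eq_mul_div, le_div_iff₀ hden]
    linarith [hE]
  have hfin : c * x ≤ c * p + D ^ 2 / (VR + D ^ 2) * (c * (1 - p) - p * d) := by linarith
  exact le_of_mul_le_mul_left (hfin.trans hmain) hc0

/-- **DIB\* AT FLOORS `7/8 ≤ x < 1` FOR NORMALISED INSTANCES**: gates in `[x², 1]`, a largest blob of size `≤ j` (any gate), credit
`> 2j` ⟹ `x ≤ P(N ≥ j+1)`.  Heavy largest: `tail_ge_of_heavyLargest_of_credit` (p275739); light largest: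
`tail_ge_of_lightLargest_of_credit`. [this work] -/
theorem tail_ge_of_largest_of_credit (a : κ → ℕ) (g : κ → ℝ) (j : ℕ) (x : ℝ) (hx : 7 / 8 ≤ x) (hx1 : x < 1)
    (hg : ∀ i, 0 ≤ g i ∧ g i ≤ 1) (hfloor : ∀ i, x ^ 2 ≤ g i) (k₀ : κ)
    (hlargest : ∀ i, a i ≤ a k₀) (hkj : a k₀ ≤ j)
    (hcredit : (2 * j : ℝ) < ∑ i, (a i : ℝ) * (if x ≤ g i then g i else (g i - x ^ 2) / (1 - x))) :
    x ≤ ∑ W : Finset κ, wt[g, W] * (if j + 1 ≤ ∑ i ∈ W, a i then (1 : ℝ) else 0) := by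
  by_cases h : x ≤ g k₀
  · exact tail_ge_of_heavyLargest_of_credit a g j x (by linarith) hx1 hg hfloor k₀ h hlargest hkj hcredit
  · exact tail_ge_of_lightLargest_of_credit a g j x hx hx1 hg hfloor k₀ (not_le.1 h) hlargest hkj hcredit

end RootDec

end Quant

end Summit.CriticalPhenomena.PercolationContinuityZ3.Theorems
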